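import Literature.Analysis.FunctionSpaces.BesselJLargeArgument
import Literature.Analysis.FunctionSpaces.BesselJProofs
import Mathlib.Analysis.SpecialFunctions.Sqrt
import Mathlib.Analysis.SpecialFunctions.Pow.Continuity
import Mathlib.MeasureTheory.Integral.IntervalIntegral.IntegrationByParts
import Mathlib.Analysis.Calculus.IteratedDeriv.Lemmas
import Mathlib.Analysis.Complex.RealDeriv
import HarnessLib

/-!
# Decay of the Hankel-type transforms `∫₀^∞ g(x) J₀(β√x) dx` for `C²` test functions: `≪ β^{-5/2}`

Topic `Analysis/FunctionSpaces` (namespace `Literature.Analysis.FunctionSpaces`), continuing `BesselJ.lean`,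
`BesselJProofs.lean` (`(xJ₁(x))' = xJ₀(x)`, `J_{n+1}' = (xJ_n − (n+1)J_{n+1})/x`) and `BesselJLargeArgument.lean`
(Hankel's asymptotic formula with an explicit error, `abs_besselJ_sub_hankel_le`).

The kernels `J₀((4π/c)√(nx))` of the Voronoi summation formula for weight-one modular forms (Conrey–Iwaniec
[ConreyIwaniec2002, Proposition 3.1 (3.11), (3.14), (3.21), (4.22)]; classically Hardy–Landau–Voronoi for `r₂(n)`)
are integrated against test functions `g` of class `C²` with compact support in `(0, ∞)`. The absolute
convergence of the dual series `Σ_n b(n) ∫ g(x) J₀((4π/c)√(nx)) dx` for divisor-bounded `b(n)` rests on the decay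
`∫₀^∞ g(x) J₀(β√x) dx ≪_g β^{-5/2}` (`β ≍ √n`, so the terms are `≪ τ(n) n^{-5/4}`), which [ConreyIwaniec2002, (4.23)]
obtains (with a twist `e(αx)`) by stationary-phase considerations. WITHOUT a twist no oscillatory analysis is
needed: the two exact antiderivatives
`(d/dx)[√x·J₁(β√x)] = (β/2)·J₀(β√x)`, `(d/dx)[x·J₂(β√x)] = (β/2)·√x·J₁(β√x)` (`x > 0`)
(Bessel's `(u^{ν}J_ν(u))' = u^{ν}J_{ν−1}(u)`, DLMF 10.6.6, at `u = β√x`) give after two integrations by parts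

* `integral_mul_besselJ_zero_sqrt_eq` — **`∫₀^∞ g(x)J₀(β√x)dx = (4/β²)∫₀^∞ g''(x)·x·J₂(β√x)dx`** (`β > 0`,
  `g : ℝ → ℂ` of class `C²` vanishing off a compact subinterval of `(0,∞)`),

and the uniform bound `|J₂(u)| ≤ 86·u^{-1/2}` (`abs_besselJ_two_le`, from `abs_besselJ_sub_hankel_le` for `u ≥ 1` and
`|J₂| ≤ 1` for `u ≤ 1`) then yields

* `norm_integral_mul_besselJ_zero_sqrt_le` — **`‖∫₀^∞ g(x)J₀(β√x)dx‖ ≤ 344·β^{-5/2}·∫₀^∞ ‖g''(x)‖·x^{3/4}dx`**.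

These are the route-independent "`J₀`-inputs" of the weight-one Voronoi formula (sub-line `theta-voronoi`, stub V2
`HeckeVoronoiWeightOne` of the cell `landau-siegel/ls-inputs`): absolute convergence of the dual series, and the
dominated-convergence passage from smooth to `C²` test functions. No new definitions; no named facts.

## References
* [ConreyIwaniec2002] B. Conrey, H. Iwaniec, Acta Arith. 103 (2002) 259–312, §3 (3.11)–(3.13), §4 (4.22)–(4.23).
* DLMF 10.6.6 (`(z^{ν}𝒞_ν(z))' = z^{ν}𝒞_{ν−1}(z)`); G. N. Watson, *A Treatise on the Theory of Bessel Functions*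
  (1944), §2.12 (5)–(6), §7.21.
-/

noncomputable section

open MeasureTheory Set Real intervalIntegral Filter
open scoped Topology

namespace Literature.Analysis.FunctionSpaces

/-! ### §1. `|J₂(u)| ≤ 86 u^{-1/2}` for all `u > 0` -/

/-- **Uniform decay of `J₂`**: `|J₂(u)| ≤ 86·u^{-1/2}` for every `u > 0` — for `u ≥ 1` from Hankel's formula with
explicit error (`abs_besselJ_sub_hankel_le`: `|J₂(u) − √(2/(πu))cos(…)| ≤ 85/u`), for `u ≤ 1` from `|J₂| ≤ 1`.
[cite: Iwaniec2002, Appendix B.4 (B.35)] -/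
theorem abs_besselJ_two_le {u : ℝ} (hu : 0 < u) : |besselJ 2 u| ≤ 86 * u ^ (-(1 / 2 : ℝ)) := by
  have hupow : u ^ (-(1 / 2 : ℝ)) = (Real.sqrt u)⁻¹ := by
    rw [Real.rpow_neg hu.le, Real.sqrt_eq_rpow]
  rw [hupow]
  have hsq : 0 < Real.sqrt u := Real.sqrt_pos.mpr hu
  rcases le_or_gt 1 u with h1 | h1
  · -- `u ≥ 1`: Hankel
    have hH := abs_besselJ_sub_hankel_le 2 hu
    have hmain : |Real.sqrt (2 / (π * u)) * Real.cos (u - 2 * π / 2 - π / 4)| ≤ (Real.sqrt u)⁻¹ := by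
      rw [abs_mul]
      have hc : |Real.cos (u - 2 * π / 2 - π / 4)| ≤ 1 := Real.abs_cos_le_one _
      have hs : |Real.sqrt (2 / (π * u))| ≤ (Real.sqrt u)⁻¹ := by
        rw [abs_of_nonneg (Real.sqrt_nonneg _), ← Real.sqrt_inv]
        apply Real.sqrt_le_sqrt
        rw [div_le_iff₀ (by positivity), inv_mul_eq_div, le_div_iff₀ hu]
        nlinarith [Real.pi_gt_three]
      calc |Real.sqrt (2 / (π * u))| * |Real.cos (u - 2 * π / 2 - π / 4)|
          ≤ (Real.sqrt u)⁻¹ * 1 := by gcongr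
        _ = (Real.sqrt u)⁻¹ := mul_one _
    have herr : 17 * (1 + (2 : ℝ) ^ 2) / u ≤ 85 * (Real.sqrt u)⁻¹ := by
      have hsu : Real.sqrt u ≤ u := by
        rw [Real.sqrt_le_left (by linarith)]
        nlinarith
      rw [div_le_iff₀ hu]
      calc 17 * (1 + (2 : ℝ) ^ 2) = 85 * ((Real.sqrt u)⁻¹ * Real.sqrt u) := by
            rw [inv_mul_cancel₀ hsq.ne']; norm_num
        _ ≤ 85 * ((Real.sqrt u)⁻¹ * u) := by gcongr
        _ = 85 * (Real.sqrt u)⁻¹ * u := by ring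
    have hn : ((2 : ℕ) : ℝ) = 2 := by norm_num
    rw [hn] at hH
    calc |besselJ 2 u|
        = |(besselJ 2 u - Real.sqrt (2 / (π * u)) * Real.cos (u - 2 * π / 2 - π / 4)) +
            Real.sqrt (2 / (π * u)) * Real.cos (u - 2 * π / 2 - π / 4)| := by ring_nf
      _ ≤ |besselJ 2 u - Real.sqrt (2 / (π * u)) * Real.cos (u - 2 * π / 2 - π / 4)| +
            |Real.sqrt (2 / (π * u)) * Real.cos (u - 2 * π / 2 - π / 4)| := abs_add_le _ _
      _ ≤ 85 * (Real.sqrt u)⁻¹ + (Real.sqrt u)⁻¹ := add_le_add (hH.trans herr) hmain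
      _ = 86 * (Real.sqrt u)⁻¹ := by ring
  · -- `u < 1`: trivial bound
    have hle : |besselJ 2 u| ≤ 1 := abs_besselJ_le_one_holds 2 u
    have hinv : 1 ≤ (Real.sqrt u)⁻¹ := by
      rw [one_le_inv₀ hsq, Real.sqrt_le_one]
      exact h1.le
    linarith

/-! ### §2. The two exact antiderivatives -/

/-- `(d/dx)[√x·J₁(β√x)] = (β/2)·J₀(β√x)` for `x > 0`, `β > 0` (chain rule on `(uJ₁(u))' = uJ₀(u)`,
`u = β√x`, `u' = β/(2√x)`). [cite: Watson1944, §2.12 (5); DLMF 10.6.6] -/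
theorem hasDerivAt_sqrt_mul_besselJ_one {β x : ℝ} (hβ : 0 < β) (hx : 0 < x) :
    HasDerivAt (fun y : ℝ => Real.sqrt y * besselJ 1 (β * Real.sqrt y))
      (β / 2 * besselJ 0 (β * Real.sqrt x)) x := by
  have hsx : 0 < Real.sqrt x := Real.sqrt_pos.mpr hx
  have hs : HasDerivAt (fun y : ℝ => β * Real.sqrt y) (β * (1 / (2 * Real.sqrt x))) x :=
    (Real.hasDerivAt_sqrt hx.ne').const_mul β
  have hh : HasDerivAt (fun u : ℝ => u * besselJ 1 u) ((β * Real.sqrt x) * besselJ 0 (β * Real.sqrt x))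
      (β * Real.sqrt x) := hasDerivAt_mul_besselJ_one _
  have hcomp := hh.comp x hs
  have heq : (fun y : ℝ => Real.sqrt y * besselJ 1 (β * Real.sqrt y)) =
      fun y => β⁻¹ * ((fun u : ℝ => u * besselJ 1 u) ∘ (fun y : ℝ => β * Real.sqrt y)) y := by
    funext y
    simp only [Function.comp]
    field_simp
  rw [heq]
  refine (hcomp.const_mul β⁻¹).congr_deriv ?_
  field_simp

/-- `(d/du)[u²·J₂(u)] = u²·J₁(u)` for `u ≠ 0` (from `J₂' = (uJ₁ − 2J₂)/u`). [cite: Watson1944, §2.12 (5); DLMF 10.6.6] -/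
theorem hasDerivAt_sq_mul_besselJ_two {u : ℝ} (hu : u ≠ 0) :
    HasDerivAt (fun v : ℝ => v ^ 2 * besselJ 2 v) (u ^ 2 * besselJ 1 u) u := by
  have h2 := hasDerivAt_besselJ_succ_of_ne_zero 1 hu
  have hp : HasDerivAt (fun v : ℝ => v ^ 2) (2 * u) u := by
    simpa using (hasDerivAt_pow 2 u)
  refine (hp.mul h2).congr_deriv ?_
  push_cast
  field_simp
  ring

/-- `(d/dx)[x·J₂(β√x)] = (β/2)·√x·J₁(β√x)` for `x > 0`, `β > 0` (chain rule on `(u²J₂(u))' = u²J₁(u)`,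
`u = β√x`; `x·J₂(β√x) = β^{-2}(β√x)²J₂(β√x)` near `x`). [cite: Watson1944, §2.12 (5); DLMF 10.6.6] -/
theorem hasDerivAt_mul_besselJ_two_sqrt {β x : ℝ} (hβ : 0 < β) (hx : 0 < x) :
    HasDerivAt (fun y : ℝ => y * besselJ 2 (β * Real.sqrt y))
      (β / 2 * (Real.sqrt x * besselJ 1 (β * Real.sqrt x))) x := by
  have hsx : 0 < Real.sqrt x := Real.sqrt_pos.mpr hx
  have hu : β * Real.sqrt x ≠ 0 := by positivity
  have hs : HasDerivAt (fun y : ℝ => β * Real.sqrt y) (β * (1 / (2 * Real.sqrt x))) x :=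
    (Real.hasDerivAt_sqrt hx.ne').const_mul β
  have hcomp := (hasDerivAt_sq_mul_besselJ_two hu).comp x hs
  -- the function agrees with `β⁻² · (u²J₂(u)) ∘ (β√·)` on a neighbourhood of `x`
  have heq : (fun y : ℝ => y * besselJ 2 (β * Real.sqrt y)) =ᶠ[𝓝 x]
      fun y => (β ^ 2)⁻¹ * ((fun v : ℝ => v ^ 2 * besselJ 2 v) ∘ (fun y : ℝ => β * Real.sqrt y)) y := by
    filter_upwards [Ioi_mem_nhds hx] with y hy
    simp only [Function.comp, mul_pow, Real.sq_sqrt (le_of_lt (mem_Ioi.mp hy))]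
    field_simp
  refine ((hcomp.const_mul (β ^ 2)⁻¹).congr_of_eventuallyEq heq).congr_deriv ?_
  have hxx : Real.sqrt x * Real.sqrt x = x := Real.mul_self_sqrt hx.le
  field_simp

/-! ### §3. Two integrations by parts -/

section IBP

variable {g : ℝ → ℂ} {X₁ X₂ : ℝ}

/-- A function vanishing off `[X₁, X₂]` vanishes near every point `x < X₁`. [folklore] -/
private theorem eventuallyEq_zero_of_lt (hsupp : ∀ x ∉ Icc X₁ X₂, g x = 0) {x : ℝ} (hx : x < X₁) :
    g =ᶠ[𝓝 x] fun _ => 0 := by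
  filter_upwards [Iio_mem_nhds hx] with y hy
  exact hsupp y (fun h => absurd h.1 (not_le.mpr hy))

/-- A function vanishing off `[X₁, X₂]` vanishes near every point `x > X₂`. [folklore] -/
private theorem eventuallyEq_zero_of_gt (hsupp : ∀ x ∉ Icc X₁ X₂, g x = 0) {x : ℝ} (hx : X₂ < x) :
    g =ᶠ[𝓝 x] fun _ => 0 := by
  filter_upwards [Ioi_mem_nhds hx] with y hy
  exact hsupp y (fun h => absurd h.2 (not_le.mpr hy))

/-- The derivative of a function vanishing off `[X₁, X₂]` vanishes off `[X₁, X₂]`. [folklore] -/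
private theorem deriv_eq_zero_of_not_mem (hsupp : ∀ x ∉ Icc X₁ X₂, g x = 0) :
    ∀ x ∉ Icc X₁ X₂, deriv g x = 0 := by
  intro x hx
  rw [mem_Icc, not_and_or, not_le, not_le] at hx
  rcases hx with hx | hx
  · rw [(eventuallyEq_zero_of_lt hsupp hx).deriv_eq, deriv_const]
  · rw [(eventuallyEq_zero_of_gt hsupp hx).deriv_eq, deriv_const]

/-- The second derivative of a function vanishing off `[X₁, X₂]` vanishes off `[X₁, X₂]`. [folklore] -/
private theorem iteratedDeriv_two_eq_zero_of_not_mem (hsupp : ∀ x ∉ Icc X₁ X₂, g x = 0) :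
    ∀ x ∉ Icc X₁ X₂, iteratedDeriv 2 g x = 0 := by
  intro x hx
  rw [iteratedDeriv_succ, iteratedDeriv_one]
  exact deriv_eq_zero_of_not_mem (deriv_eq_zero_of_not_mem hsupp) x hx

/-- An integral over `(0, ∞)` of a function vanishing off `[X₁, X₂] ⊆ (a, b]`, `0 < a`, is the interval
integral over `[a, b]`. [folklore] -/
private theorem setIntegral_Ioi_eq_intervalIntegral {f : ℝ → ℂ} {a b : ℝ} (ha : 0 < a) (hab : a ≤ b)
    (haX : a < X₁) (hXb : X₂ ≤ b) (hf : ∀ x ∉ Icc X₁ X₂, f x = 0) :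
    ∫ x in Ioi (0 : ℝ), f x = ∫ x in a..b, f x := by
  rw [intervalIntegral.integral_of_le hab,
    setIntegral_eq_integral_of_forall_compl_eq_zero, setIntegral_eq_integral_of_forall_compl_eq_zero]
  · intro x hx
    refine hf x (fun h => hx ⟨?_, h.2.trans hXb⟩)
    exact lt_of_lt_of_le haX h.1
  · intro x hx
    refine hf x (fun h => hx ?_)
    exact lt_of_lt_of_le (ha.trans haX) h.1

variable (hg : ContDiff ℝ 2 g) (hsupp : ∀ x ∉ Icc X₁ X₂, g x = 0)
include hg hsupp

/-- **First integration by parts**: `(β/2)∫_a^b g(x)J₀(β√x)dx = −∫_a^b g'(x)·√x·J₁(β√x)dx` on any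
`[a, b] ⊇ [X₁, X₂]` with `0 < a < X₁`, `X₂ < b`. [folklore] -/
private theorem integral_mul_besselJ_zero_sqrt_ibp_one {β a b : ℝ} (hβ : 0 < β) (ha : 0 < a) (haX : a < X₁)
    (hXb : X₂ < b) (hab : a ≤ b) :
    ∫ x in a..b, g x * (((β / 2 * besselJ 0 (β * Real.sqrt x) : ℝ) : ℂ)) =
      -∫ x in a..b, deriv g x * (((Real.sqrt x * besselJ 1 (β * Real.sqrt x) : ℝ) : ℂ)) := by
  have hcontJ : ∀ n : ℕ, Continuous (besselJ n) := continuous_besselJ_holds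
  have hga : g a = 0 := hsupp a (fun h => absurd h.1 (not_le.mpr haX))
  have hgb : g b = 0 := hsupp b (fun h => absurd h.2 (not_le.mpr hXb))
  have hu : ∀ x ∈ uIcc a b, HasDerivAt g (deriv g x) x := fun x _ =>
    ((hg.differentiable (by norm_num)) x).hasDerivAt
  have hv : ∀ x ∈ uIcc a b, HasDerivAt (fun y : ℝ => ((Real.sqrt y * besselJ 1 (β * Real.sqrt y) : ℝ) : ℂ))
      (((β / 2 * besselJ 0 (β * Real.sqrt x) : ℝ) : ℂ)) x := by
    intro x hx
    rw [uIcc_of_le hab] at hx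
    exact (hasDerivAt_sqrt_mul_besselJ_one hβ (ha.trans_le hx.1)).ofReal_comp
  have hu' : IntervalIntegrable (deriv g) volume a b :=
    (hg.continuous_deriv (by norm_num)).intervalIntegrable _ _
  have hv' : IntervalIntegrable (fun x : ℝ => (((β / 2 * besselJ 0 (β * Real.sqrt x) : ℝ) : ℂ))) volume a b := by
    apply Continuous.intervalIntegrable
    exact Complex.continuous_ofReal.comp
      (continuous_const.mul ((hcontJ 0).comp (continuous_const.mul Real.continuous_sqrt)))
  have h := intervalIntegral.integral_mul_deriv_eq_deriv_mul hu hv hu' hv'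
  rw [h, hga, hgb]
  simp

/-- **Second integration by parts**: `(β/2)∫_a^b g'(x)·√x·J₁(β√x)dx = −∫_a^b g''(x)·x·J₂(β√x)dx`.
[folklore] -/
private theorem integral_mul_besselJ_zero_sqrt_ibp_two {β a b : ℝ} (hβ : 0 < β) (ha : 0 < a) (haX : a < X₁)
    (hXb : X₂ < b) (hab : a ≤ b) :
    ∫ x in a..b, deriv g x * (((β / 2 * (Real.sqrt x * besselJ 1 (β * Real.sqrt x)) : ℝ) : ℂ)) =
      -∫ x in a..b, iteratedDeriv 2 g x * (((x * besselJ 2 (β * Real.sqrt x) : ℝ) : ℂ)) := by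
  have hcontJ : ∀ n : ℕ, Continuous (besselJ n) := continuous_besselJ_holds
  have hd0 := deriv_eq_zero_of_not_mem hsupp
  have hga : deriv g a = 0 := hd0 a (fun h => absurd h.1 (not_le.mpr haX))
  have hgb : deriv g b = 0 := hd0 b (fun h => absurd h.2 (not_le.mpr hXb))
  have h2 : iteratedDeriv 2 g = deriv (deriv g) := by
    rw [iteratedDeriv_succ, iteratedDeriv_one]
  have hu : ∀ x ∈ uIcc a b, HasDerivAt (deriv g) (iteratedDeriv 2 g x) x := fun x _ => by
    rw [h2]
    exact (hg.differentiable_deriv_two x).hasDerivAt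
  have hv : ∀ x ∈ uIcc a b, HasDerivAt (fun y : ℝ => ((y * besselJ 2 (β * Real.sqrt y) : ℝ) : ℂ))
      (((β / 2 * (Real.sqrt x * besselJ 1 (β * Real.sqrt x)) : ℝ) : ℂ)) x := by
    intro x hx
    rw [uIcc_of_le hab] at hx
    exact (hasDerivAt_mul_besselJ_two_sqrt hβ (ha.trans_le hx.1)).ofReal_comp
  have hu' : IntervalIntegrable (iteratedDeriv 2 g) volume a b :=
    (hg.continuous_iteratedDeriv' 2).intervalIntegrable _ _
  have hv' : IntervalIntegrable
      (fun x : ℝ => (((β / 2 * (Real.sqrt x * besselJ 1 (β * Real.sqrt x)) : ℝ) : ℂ))) volume a b := by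
    apply Continuous.intervalIntegrable
    exact Complex.continuous_ofReal.comp (continuous_const.mul
      (Real.continuous_sqrt.mul ((hcontJ 1).comp (continuous_const.mul Real.continuous_sqrt))))
  have h := intervalIntegral.integral_mul_deriv_eq_deriv_mul hu hv hu' hv'
  rw [h, hga, hgb]
  simp

/-- **`∫₀^∞ g(x)J₀(β√x)dx = (4/β²)∫₀^∞ g''(x)·x·J₂(β√x)dx`** for `β > 0` and `g : ℝ → ℂ` of class `C²` vanishing
off a compact subinterval `[X₁, X₂]` of `(0, ∞)` — two integrations by parts with the exact antiderivatives
`(√xJ₁(β√x))' = (β/2)J₀(β√x)`, `(xJ₂(β√x))' = (β/2)√xJ₁(β√x)`; no boundary terms. (The Hankel-type transform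
of [ConreyIwaniec2002, (3.11)/(3.13)] at `β = 4π√n/C`.) [cite: ConreyIwaniec2002, Proposition 3.1 (3.11)–(3.13)] -/
theorem integral_mul_besselJ_zero_sqrt_eq (hX₁ : 0 < X₁) {β : ℝ} (hβ : 0 < β) :
    ∫ x in Ioi (0 : ℝ), g x * ((besselJ 0 (β * Real.sqrt x) : ℝ) : ℂ) =
      (4 / β ^ 2 : ℂ) * ∫ x in Ioi (0 : ℝ), iteratedDeriv 2 g x * (((x * besselJ 2 (β * Real.sqrt x) : ℝ) : ℂ)) := by
  set a : ℝ := X₁ / 2 with ha_def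
  set b : ℝ := max X₁ X₂ + 1 with hb_def
  have ha : 0 < a := by rw [ha_def]; linarith
  have haX : a < X₁ := by rw [ha_def]; linarith
  have hXb : X₂ < b := by rw [hb_def]; linarith [le_max_right X₁ X₂]
  have hab : a ≤ b := by rw [ha_def, hb_def]; linarith [le_max_left X₁ X₂]
  have hd2 := iteratedDeriv_two_eq_zero_of_not_mem hsupp
  rw [setIntegral_Ioi_eq_intervalIntegral ha hab haX hXb.le
      (f := fun x => g x * ((besselJ 0 (β * Real.sqrt x) : ℝ) : ℂ))
      (fun x hx => by rw [hsupp x hx, zero_mul]),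
    setIntegral_Ioi_eq_intervalIntegral ha hab haX hXb.le
      (f := fun x => iteratedDeriv 2 g x * (((x * besselJ 2 (β * Real.sqrt x) : ℝ) : ℂ)))
      (fun x hx => by rw [hd2 x hx, zero_mul])]
  have h1 := integral_mul_besselJ_zero_sqrt_ibp_one hg hsupp hβ ha haX hXb hab
  have h2 := integral_mul_besselJ_zero_sqrt_ibp_two hg hsupp hβ ha haX hXb hab
  have hβ0 : (β : ℂ) ≠ 0 := by exact_mod_cast hβ.ne'
  -- `(β/2) I = -∫ g'·F` and `(β/2) ∫ g'·F = -∫ g''·G`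
  have e1 : ∫ x in a..b, g x * ((besselJ 0 (β * Real.sqrt x) : ℝ) : ℂ) =
      (2 / β : ℂ) * ∫ x in a..b, g x * (((β / 2 * besselJ 0 (β * Real.sqrt x) : ℝ) : ℂ)) := by
    rw [← intervalIntegral.integral_const_mul]
    congr 1
    funext x
    push_cast
    field_simp
  have e2 : ∫ x in a..b, deriv g x * (((Real.sqrt x * besselJ 1 (β * Real.sqrt x) : ℝ) : ℂ)) =
      (2 / β : ℂ) * ∫ x in a..b,
        deriv g x * (((β / 2 * (Real.sqrt x * besselJ 1 (β * Real.sqrt x)) : ℝ) : ℂ)) := by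
    rw [← intervalIntegral.integral_const_mul]
    congr 1
    funext x
    push_cast
    field_simp
  rw [e1, h1, e2, h2]
  field_simp
  ring

/-- **`‖∫₀^∞ g(x)J₀(β√x)dx‖ ≤ 344·β^{-5/2}·∫₀^∞‖g''(x)‖x^{3/4}dx`** (`β > 0`, `g : ℝ → ℂ` of class `C²` vanishing off a
compact subinterval of `(0,∞)`): `integral_mul_besselJ_zero_sqrt_eq` and `|xJ₂(β√x)| ≤ 86β^{-1/2}x^{3/4}`
(`abs_besselJ_two_le`). With `β = (4π/C)√n` this is the bound `≪ C^{5/2}n^{-5/4}` that makes the dual series of the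
weight-one Voronoi formula converge absolutely for `C²` test functions and divisor-bounded coefficients.
[cite: ConreyIwaniec2002, §4 (4.23); Proposition 3.1 (3.11)] -/
theorem norm_integral_mul_besselJ_zero_sqrt_le (hX₁ : 0 < X₁) {β : ℝ} (hβ : 0 < β) :
    ‖∫ x in Ioi (0 : ℝ), g x * ((besselJ 0 (β * Real.sqrt x) : ℝ) : ℂ)‖ ≤
      344 * β ^ (-(5 / 2 : ℝ)) * ∫ x in Ioi (0 : ℝ), ‖iteratedDeriv 2 g x‖ * x ^ (3 / 4 : ℝ) := by
  rw [integral_mul_besselJ_zero_sqrt_eq hg hsupp hX₁ hβ, norm_mul]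
  have hn4 : ‖(4 / β ^ 2 : ℂ)‖ = 4 / β ^ 2 := by
    rw [norm_div, Complex.norm_pow, Complex.norm_real, Real.norm_of_nonneg hβ.le]
    simp
  rw [hn4]
  -- pointwise bound on `(0, ∞)`
  have hpt : ∀ x ∈ Ioi (0 : ℝ),
      ‖iteratedDeriv 2 g x * (((x * besselJ 2 (β * Real.sqrt x) : ℝ) : ℂ))‖ ≤
        86 * β ^ (-(1 / 2 : ℝ)) * (‖iteratedDeriv 2 g x‖ * x ^ (3 / 4 : ℝ)) := by
    intro x hx
    have hx0 : 0 < x := hx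
    have hsx : 0 < Real.sqrt x := Real.sqrt_pos.mpr hx0
    rw [norm_mul, Complex.norm_real, Real.norm_eq_abs, abs_mul, abs_of_pos hx0]
    have hJ := abs_besselJ_two_le (u := β * Real.sqrt x) (by positivity)
    have hsplit : (β * Real.sqrt x) ^ (-(1 / 2 : ℝ)) = β ^ (-(1 / 2 : ℝ)) * x ^ (-(1 / 4 : ℝ)) := by
      rw [Real.mul_rpow hβ.le hsx.le, Real.sqrt_eq_rpow, ← Real.rpow_mul hx0.le]
      norm_num
    have hx34 : x * x ^ (-(1 / 4 : ℝ)) = x ^ (3 / 4 : ℝ) := by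
      conv_lhs => rw [show x * x ^ (-(1 / 4 : ℝ)) = x ^ (1 : ℝ) * x ^ (-(1 / 4 : ℝ)) by rw [Real.rpow_one]]
      rw [← Real.rpow_add hx0]
      norm_num
    calc ‖iteratedDeriv 2 g x‖ * (x * |besselJ 2 (β * Real.sqrt x)|)
        ≤ ‖iteratedDeriv 2 g x‖ * (x * (86 * (β * Real.sqrt x) ^ (-(1 / 2 : ℝ)))) := by gcongr
      _ = 86 * β ^ (-(1 / 2 : ℝ)) * (‖iteratedDeriv 2 g x‖ * (x * x ^ (-(1 / 4 : ℝ)))) := by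
          rw [hsplit]; ring
      _ = 86 * β ^ (-(1 / 2 : ℝ)) * (‖iteratedDeriv 2 g x‖ * x ^ (3 / 4 : ℝ)) := by rw [hx34]
  have hI : ‖∫ x in Ioi (0 : ℝ), iteratedDeriv 2 g x * (((x * besselJ 2 (β * Real.sqrt x) : ℝ) : ℂ))‖ ≤
      ∫ x in Ioi (0 : ℝ), 86 * β ^ (-(1 / 2 : ℝ)) * (‖iteratedDeriv 2 g x‖ * x ^ (3 / 4 : ℝ)) := by
    refine norm_integral_le_of_norm_le ?_ ?_
    · -- integrability of the majorant: continuous with support in `[X₁, X₂]`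
      have hcont : Continuous fun x : ℝ => 86 * β ^ (-(1 / 2 : ℝ)) * (‖iteratedDeriv 2 g x‖ * x ^ (3 / 4 : ℝ)) := by
        refine continuous_const.mul (((hg.continuous_iteratedDeriv' 2).norm).mul ?_)
        exact Real.continuous_rpow_const (by norm_num)
      have hsup : HasCompactSupport fun x : ℝ => 86 * β ^ (-(1 / 2 : ℝ)) * (‖iteratedDeriv 2 g x‖ * x ^ (3 / 4 : ℝ)) := by
        refine HasCompactSupport.of_support_subset_isCompact isCompact_Icc (K := Icc X₁ X₂) ?_
        intro x hx
        by_contra hxK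
        apply hx
        simp [iteratedDeriv_two_eq_zero_of_not_mem hsupp x hxK]
      exact (hcont.integrable_of_hasCompactSupport hsup).integrableOn
    · exact (ae_restrict_mem measurableSet_Ioi).mono hpt
  rw [MeasureTheory.integral_const_mul] at hI
  have hb2 : 4 / β ^ 2 * (86 * β ^ (-(1 / 2 : ℝ))) = 344 * β ^ (-(5 / 2 : ℝ)) := by
    have h1 : β ^ (-(5 / 2 : ℝ)) = β ^ (-(2 : ℝ)) * β ^ (-(1 / 2 : ℝ)) := by
      rw [← Real.rpow_add hβ]; norm_num
    have h2 : β ^ (-(2 : ℝ)) = (β ^ 2)⁻¹ := by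
      rw [Real.rpow_neg hβ.le, Real.rpow_two]
    rw [h1, h2]
    ring
  have hpos : 0 ≤ ∫ x in Ioi (0 : ℝ), ‖iteratedDeriv 2 g x‖ * x ^ (3 / 4 : ℝ) :=
    setIntegral_nonneg measurableSet_Ioi (fun x hx => by
      have : 0 ≤ x ^ (3 / 4 : ℝ) := Real.rpow_nonneg (le_of_lt hx) _
      positivity)
  calc 4 / β ^ 2 * ‖∫ x in Ioi (0 : ℝ), iteratedDeriv 2 g x * (((x * besselJ 2 (β * Real.sqrt x) : ℝ) : ℂ))‖
      ≤ 4 / β ^ 2 * (86 * β ^ (-(1 / 2 : ℝ)) * ∫ x in Ioi (0 : ℝ), ‖iteratedDeriv 2 g x‖ * x ^ (3 / 4 : ℝ)) := by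
        gcongr
    _ = 344 * β ^ (-(5 / 2 : ℝ)) * ∫ x in Ioi (0 : ℝ), ‖iteratedDeriv 2 g x‖ * x ^ (3 / 4 : ℝ) := by
        rw [← mul_assoc, hb2]

end IBP

end Literature.Analysis.FunctionSpaces
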